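import Mathlib
import Literature.Analysis.Calculus.ClosedSubgroupExpChart
import Literature.Analysis.Calculus.ClosedSubgroupTubularChart
import HarnessLib

/-!
# Crux `ExtremalSpiralSymmetry` (stmt-NavierStokesRegularity-8215), line `registered`:
  STUB `stub_closedSubgroupCharacter` — a character of a closed linear group with open image has a
  unit-speed one-parameter subgroup

Lands `--supports stmt-NavierStokesRegularity-8215` the registered stub `stub_closedSubgroupCharacter`
of the lead's skeleton `Cruxes/ExtremalSpiralSymmetry/Lines/birth.lean` (crux
`Summit.NavierStokesRegularity.NavierStokesRegularity.Theses.ExtremalTypeIConstant.ExtremalSpiralSymmetry`).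

Statement: let `H` be a subgroup of the units of a finite-dimensional real Banach algebra `𝔸`, closed
in `𝔸`, and `ℓ : 𝔸 →L[ℝ] ℝ` a linear functional which is multiplicative on `H` and whose values on
`H` cover a neighbourhood of `1`. Then some one-parameter subgroup `t ↦ exp (t • X)` of `H` has
`ℓ X = 1`.

Proof (von Neumann 1929 / É. Cartan): the set `𝔥` of generators of one-parameter subgroups of `H`
is closed under scalars, so it suffices to find `X ∈ 𝔥` with `ℓ X ≠ 0`. If there were none, then
for `X ∈ 𝔥` the function `t ↦ ℓ (exp (tX))` is multiplicative with derivative `ℓ X = 0` at `0`,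
hence with zero derivative everywhere, hence `≡ ℓ 1 = 1`; by the exponential chart of a closed
linear group (`Literature.Analysis.Calculus.exists_exp_chart_of_isClosed`) every `u ∈ H` near `1`
is such an `exp X`, so `ℓ ≡ 1` on `H` near `1`, so `ℓ|_H` is locally constant (translate by a left
inverse), so its fibres are pairwise disjoint nonempty open subsets of the second-countable space
`H` and `ℓ '' H` is countable — contradicting `Ioo (1 - δ) (1 + δ) ⊆ ℓ '' H`.
-/

noncomputable section

open NormedSpace Filter Topology Set

set_option linter.dupNamespace false

namespace Summit.NavierStokesRegularity.NavierStokesRegularity.Theorems.ExtremalSpiralSymmetry.Registered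

section Helpers

variable {𝔸 : Type*} [NormedRing 𝔸] [NormedAlgebra ℚ 𝔸] [NormedAlgebra ℝ 𝔸] [CompleteSpace 𝔸]
  {H : Set 𝔸}

/-- A character `ℓ` of `H` (with `ℓ 1 = 1`) which kills the generator `X` of a one-parameter
subgroup of `H` is `≡ 1` along that subgroup: `t ↦ ℓ (exp (tX))` is multiplicative, so its
derivative at `t` is its value at `t` times its derivative `ℓ X = 0` at `0`. -/
theorem char_exp_smul_eq_one (ℓ : 𝔸 →L[ℝ] ℝ) (hchar : ∀ a ∈ H, ∀ b ∈ H, ℓ (a * b) = ℓ a * ℓ b)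
    (hℓ1 : ℓ 1 = 1) {X : 𝔸} (hX : ∀ t : ℝ, exp (t • X) ∈ H) (hℓX : ℓ X = 0) (t : ℝ) :
    ℓ (exp (t • X)) = 1 := by
  set f : ℝ → ℝ := fun s => ℓ (exp (s • X)) with hf
  have hmulf : ∀ s r : ℝ, f (s + r) = f s * f r := fun s r => by
    simp only [hf]
    rw [add_smul, exp_add_of_commute (((Commute.refl X).smul_left s).smul_right r),
      hchar _ (hX s) _ (hX r)]
  have hf0 : HasDerivAt f (ℓ X) 0 := by
    have h := hasDerivAt_exp_smul_const X (0 : ℝ)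
    rw [zero_smul, exp_zero, one_mul] at h
    exact ℓ.hasFDerivAt.comp_hasDerivAt (0 : ℝ) h
  have hderiv : ∀ s : ℝ, HasDerivAt f 0 s := fun s => by
    have h0 : HasDerivAt f (ℓ X) (s - s) := by rw [sub_self]; exact hf0
    have h1 : HasDerivAt (fun r : ℝ => f (r - s)) (ℓ X) s := h0.comp_sub_const s s
    have h2 : HasDerivAt (fun r : ℝ => f s * f (r - s)) (f s * ℓ X) s := h1.const_mul (f s)
    rw [hℓX, mul_zero] at h2
    refine h2.congr_of_eventuallyEq (Eventually.of_forall fun r => ?_)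
    change f r = f s * f (r - s)
    rw [← hmulf, add_sub_cancel]
  have hdiff : Differentiable ℝ f := fun s => (hderiv s).differentiableAt
  have hconst : f t = f 0 := is_const_of_deriv_eq_zero hdiff (fun s => (hderiv s).deriv) t 0
  have hf00 : f 0 = 1 := by simp [hf, hℓ1]
  rw [hf00] at hconst
  exact hconst

end Helpers

/-- **STUB `stub_closedSubgroupCharacter`** (von Neumann–Cartan for linear groups, plus a
countability argument). Let `H` be a subgroup of the units of a finite-dimensional real Banach
algebra `𝔸`, closed in `𝔸`, and `ℓ : 𝔸 →L[ℝ] ℝ` a linear functional multiplicative on `H`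
(a character) whose values on `H` cover a neighbourhood of `1`. Then some one-parameter subgroup
`t ↦ exp (t • X)` of `H` has unit character speed `ℓ X = 1`. -/
theorem stub_closedSubgroupCharacter :
    ∀ {𝔸 : Type} [NormedRing 𝔸] [NormedAlgebra ℚ 𝔸] [NormedAlgebra ℝ 𝔸] [CompleteSpace 𝔸]
      [FiniteDimensional ℝ 𝔸] (H : Set 𝔸) (ℓ : 𝔸 →L[ℝ] ℝ),
      IsClosed H → (1 : 𝔸) ∈ H → (∀ a ∈ H, ∀ b ∈ H, a * b ∈ H) → (∀ a ∈ H, ∃ b ∈ H, b * a = 1) →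
      (∀ a ∈ H, ∀ b ∈ H, ℓ (a * b) = ℓ a * ℓ b) →
      (∃ δ : ℝ, 0 < δ ∧ Set.Ioo (1 - δ) (1 + δ) ⊆ ℓ '' H) →
      ∃ X : 𝔸, ℓ X = 1 ∧ ∀ t : ℝ, NormedSpace.exp (t • X) ∈ H := by
  intro 𝔸 _ _ _ _ _ H ℓ hH h1 hmul hinv hchar hδ
  obtain ⟨δ, hδ, hsub⟩ := hδ
  by_cases hex : ∃ X : 𝔸, (∀ t : ℝ, exp (t • X) ∈ H) ∧ ℓ X ≠ 0
  · obtain ⟨X, hX, hℓX⟩ := hex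
    refine ⟨(ℓ X)⁻¹ • X, by simp [hℓX], fun t => ?_⟩
    rw [smul_smul]
    exact hX _
  exfalso
  push Not at hex
  -- (0) `ℓ 1 = 1`
  have hℓ1 : ℓ 1 = 1 := by
    have h11 : ℓ 1 * ℓ 1 = ℓ 1 := by rw [← hchar _ h1 _ h1, one_mul]
    obtain ⟨a, ha, ha1⟩ := hsub (show (1 : ℝ) ∈ Set.Ioo (1 - δ) (1 + δ) from
      ⟨by linarith, by linarith⟩)
    have hℓa : ℓ a = ℓ a * ℓ 1 := by rw [← hchar _ ha _ h1, mul_one]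
    rw [ha1, one_mul] at hℓa
    exact hℓa.symm
  -- (1) `ℓ ≡ 1` on `H` near `1`, by the exponential chart
  obtain ⟨r, hr, hchart⟩ :=
    Literature.Analysis.Calculus.exists_exp_chart_of_isClosed hH h1 hmul hinv
  have hnear : ∀ u ∈ H, ‖u - 1‖ < r → ℓ u = 1 := fun u hu hur => by
    obtain ⟨X, hX, hXu, -⟩ := hchart u hu hur
    have := char_exp_smul_eq_one ℓ hchar hℓ1 hX (hex X hX) 1
    rwa [one_smul, hXu] at this
  -- (2) `ℓ|_H` is locally constant
  have hloc : ∀ h ∈ H, ∃ ε : ℝ, 0 < ε ∧ ∀ g ∈ H, ‖g - h‖ < ε → ℓ g = ℓ h := fun h hh => by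
    obtain ⟨b, hb, hbh⟩ := hinv h hh
    refine ⟨r / (‖b‖ + 1), by positivity, fun g hg hgh => ?_⟩
    have hbg : ℓ (b * g) = 1 := by
      refine hnear _ (hmul _ hb _ hg) ?_
      calc ‖b * g - 1‖ = ‖b * (g - h)‖ := by rw [mul_sub, hbh]
        _ ≤ ‖b‖ * ‖g - h‖ := norm_mul_le _ _
        _ ≤ (‖b‖ + 1) * ‖g - h‖ := by gcongr; linarith
        _ < (‖b‖ + 1) * (r / (‖b‖ + 1)) := by gcongr
        _ = r := by field_simp
    have h1g : ℓ b * ℓ g = 1 := by rw [← hchar _ hb _ hg, hbg]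
    have h1h : ℓ b * ℓ h = 1 := by rw [← hchar _ hb _ hh, hbh, hℓ1]
    exact mul_left_cancel₀ (left_ne_zero_of_mul_eq_one h1h) (h1g.trans h1h.symm)
  -- (3) the fibres of `ℓ|_H` are disjoint nonempty open subsets of the separable space `H`
  haveI : ProperSpace 𝔸 := FiniteDimensional.proper ℝ 𝔸
  let s : ℝ → Set H := fun v => {g : H | ℓ (g : 𝔸) = v}
  have hdisj : (ℓ '' H).PairwiseDisjoint s := by
    intro v _ w _ hvw
    refine Set.disjoint_left.2 fun g hgv hgw => hvw ?_
    exact hgv.symm.trans hgw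
  have hopen : ∀ v ∈ ℓ '' H, IsOpen (s v) := fun v _ => by
    refine Metric.isOpen_iff.2 fun g hg => ?_
    obtain ⟨ε, hε, hεg⟩ := hloc (g : 𝔸) g.2
    refine ⟨ε, hε, fun g' hg' => ?_⟩
    have hd : ‖(g' : 𝔸) - g‖ < ε := by
      rw [← dist_eq_norm]
      exact hg'
    change ℓ (g' : 𝔸) = v
    rw [hεg _ g'.2 hd]
    exact hg
  have hne : ∀ v ∈ ℓ '' H, (s v).Nonempty := by
    rintro v ⟨g, hg, rfl⟩
    exact ⟨⟨g, hg⟩, rfl⟩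
  have hcount : (ℓ '' H).Countable := hdisj.countable_of_isOpen hopen hne
  -- (4) but `ℓ '' H` contains a nondegenerate interval
  have hIoo : (Set.Ioo (1 - δ) (1 + δ)).Countable := hcount.mono hsub
  have hle : Cardinal.mk (Set.Ioo (1 - δ) (1 + δ)) ≤ Cardinal.aleph0 :=
    Cardinal.mk_le_aleph0_iff.2 hIoo.to_subtype
  rw [Cardinal.mk_Ioo_real (by linarith)] at hle
  exact (Cardinal.aleph0_lt_continuum.trans_le hle).false

end Summit.NavierStokesRegularity.NavierStokesRegularity.Theorems.ExtremalSpiralSymmetry.Registered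

end
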